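import Summits.BirchSwinnertonDyer.BirchSwinnertonDyer.Theorems.ErratumRoadFiveIMCDivOneSidedCongruenceLeDefs
import HarnessLib

/-!
# Route `ErratumRoadFive`, crux `IMCDivAtErratumDataAll` (item stmt-BirchSwinnertonDyer-19270):
# Road FF COEFFICIENT-FREE INPUT CUT — `Σ`-data and the FITTING-LEVEL congruence frame, two named
# datum-level predicates, their recombination to the crux's datum-level conclusion, and the
# erratum-data-level wrappers

Cell `bsd-stepL` (run/shared/lean/pub/bsd-stepL/), seat `bsd-stepL-imc-p1` (prover, session g8), task t1
of planner g29 RULING 1/3 (second, coefficient-free form); `--supports stmt-BirchSwinnertonDyer-19270 --as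
helper`. Companion of `Theorems/ErratumRoadFiveIMCDivRoadFFAssemblyDefs.lean` (the member-level cut in the
`Λ`-currency of the package of record).

## Why a second cut

The Road FF members `g_m ≡ f (mod p^m)` have their own coefficient rings `𝒪_m ⊋ ℤ_p`; a member-level
cut in `Λ`-currency (`N_m` a `Λ`-module with `X^Σ/p^m ≅ N_m/p^m`, `L_m ∈ R₀⟦T⟧`) is the case `𝒪_m = ℤ_p`.
But the members enter the erratum's argument [Castella2018Erratum, p. 4; Skinner2016PacificMC §3.1] only
through ONE coefficient-free consequence in `Λ ∕ R₀⟦T⟧`-currency: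

  `Fitt₀_Λ(X^Σ_ac(E[p^∞]))·R₀⟦T⟧ ⊆ (L^Σ)`,

obtained per `m` over `𝒪_m` and contracted to `R₀⟦T⟧` by faithful flatness (imc24c's
`Theorems/ErratumRoadFiveIMCDivCongruenceCoefficientDescent.lean`; one-sided (c) version by this seat,
`…CongruenceCoefficientDescentLe.lean`), after which imc24b's
`AcSelmer.XAc.charIdeal_map_toUnr_le_span_of_map_fittingIdeal_le` (torsion bounds, `Σ`-removal, two-prime
cancellation; NO Lemma 2.2) gives `Ch_Λ(X^∅)·R₀⟦T⟧ ⊆ (L)`. Cutting THERE makes the stubs independent of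
`𝒪_m`, of the member predicate, and of the Hida-family vocabulary:

* `P2.RoadFF.SigmaDataAt W p κ 𝔭 γ S PS` — E-side, algebraic: `Σ` finite, `X^Σ` `Λ`-torsion [CTL],
  `P_Σ ≠ 0`, `Ch(X^∅)·(P_Σ) ⊆ Ch(X^Σ)` [Cas18 (3.1), algebraic half; GREENBERG–VATSAL-type `Σ`-comparison];
* `P2.RoadFF.FittingCongruenceFrameAt W p κ 𝔭 γ ι f S PS` — an `R₀`-frame `(Ω_K, Ω_p, L)` for `f` [Cas18
  Thm. 3.1], a `Σ`-imprimitive `L^Σ` with `L·φ(P_Σ) ∣ L^Σ` [Cas18 (3.1)], and THE MEMBER LIMIT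
  `Fitt₀_Λ(X^Σ)·R₀⟦T⟧ ⊆ (L^Σ)` [Erratum (b)+(c)+Lemma 2.1+(2.5)_m for all `m`, FW21 4.41, descended].

Shared datum-level parameters: `S = Σ` and `PS = P_Σ` only (typer currency: `bsd-stepL-defn-ty1`'s
`Literature/NumberTheory/EllipticCurves/SigmaEulerFactors.lean`). PROVED: the recombination
`P2.exists_unrFrame_charIdeal_map_le_of_roadFF_fitting` ∕ `P2.exists_intCoreFrame_of_roadFF_fitting`
(⟹ the crux's datum-level ♭-frame conclusion), the erratum-data-level glue
`P2.imcDivIntCoreFrameAtErratumData_of_roadFF_fitting` (two predicates at every erratum datum, for ANY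
choice functions `Σ`, `P_Σ` ⟹ `P2.IMCDivIntCoreFrameAtErratumData W p`, the shape of crux 19270), and the
comparison with the package of record (`P2.OneSidedCongruenceDataLeAt ⟹` both predicates for some
`(S, PS)`). Shapes assert nothing; theorems are unconditional regroupings + the cited tree lemmas.
-/

set_option autoImplicit false

noncomputable section

open scoped Classical

open WeierstrassCurve NumberField IsDedekindDomain Field PowerSeries
open Literature.NumberTheory.EllipticCurves Literature.NumberTheory.EllipticCurves.GreenbergSelmer
  Literature.NumberTheory.EllipticCurves.ModularForms Literature.NumberTheory.EllipticCurves.Rank1Residual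
  Literature.NumberTheory.EllipticCurves.Rank1Residual.Typed Literature.NumberTheory.EllipticCurves.Castella2018
  Literature.NumberTheory.EllipticCurves.Module Literature.NumberTheory.GaloisRepresentations
  Literature.NumberTheory.GaloisCohomology Literature.RingTheory.FittingIdeal
open Summit.BirchSwinnertonDyer.Rank1Residual.X11b.AcSelmer Summit.BirchSwinnertonDyer.Rank1Residual.X11b.Halves

namespace Summit.BirchSwinnertonDyer.Rank1Residual.X11b

section Shapes

variable {K : Type} [Field K] [NumberField K] (W : WeierstrassCurve ℚ) (p : ℕ) [Fact p.Prime]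
  (κ : ZpExtension K p) (𝔭 : HeightOneSpectrum (𝓞 K)) (γ : Field.absoluteGaloisGroup K)
  [Fact (κ.IsTopGenerator γ)] (ι : PadicAlgCl p ≃+* ℂ) {N : ℕ}
  (f : CuspForm (CongruenceSubgroup.Gamma0 N) 2)
  (S : Set (HeightOneSpectrum (𝓞 K))) (PS : IwasawaAlgebra p)

/-- **ROAD FF, `Σ`-DATA AT A DATUM (shape; asserts nothing)** — the E-side algebraic inputs of the
erratum's argument for the finite set `S = Σ` and the `Σ`-Euler element `PS = P_Σ ∈ Λ`: `Σ` finite;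
`X^Σ_ac(E/K)` `Λ`-torsion [CTL]; `P_Σ ≠ 0`; `Ch_Λ(X^∅)·(P_Σ) ⊆ Ch_Λ(X^Σ)` [Cas18 (3.1), algebraic half].
Coefficient-free (`Λ = ℤ_p⟦T⟧`). A predicate; NEVER a theorem in this cell.
[claim: Castella2018Erratum, status: under-review]
[cite: Castella2018Erratum, proof of Thm. 1.1 (p. 4) (shape only; nothing asserted)]
[cite: Castella2018, (3.1) (arXiv:1704.06608 p. 9) (shape only; nothing asserted)] -/
@[conjecture]
def P2.RoadFF.SigmaDataAt : Prop :=
  S.Finite ∧ Module.IsTorsion (IwasawaAlgebra p) (XAc (W.baseChange K) p κ 𝔭 S γ) ∧ PS ≠ 0 ∧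
    XAc.charIdeal (W.baseChange K) p κ 𝔭 ∅ γ * Ideal.span {PS} ≤ XAc.charIdeal (W.baseChange K) p κ 𝔭 S γ

/-- **ROAD FF, FITTING-LEVEL CONGRUENCE FRAME AT A DATUM (shape; asserts nothing)** — an `R₀`-frame
`(Ω_K ≠ 0, Ω_p ∈ R₀ˣ, L)` with `IsBDPLFunction ι 𝔭 κ γ f Ω_K Ω_p L` [Cas18 Thm. 3.1]; a `Σ`-imprimitive
`L^Σ ∈ R₀⟦T⟧` with `L·φ(P_Σ) ∣ L^Σ` [Cas18 (3.1), analytic half]; and THE MEMBER LIMIT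
`Fitt₀_Λ(X^Σ_ac(E/K))·R₀⟦T⟧ ⊆ (L^Σ)` — the single coefficient-free consequence of the Hida members
`g_m ≡ f (mod p^m)` [Erratum (b), Lemma 2.1, (2.5)_m = FW21 Thm. 4.41 at `p ∥ N` (PREPRINT), (c) = Cas18
(4.1) + `ν_{g_m} ≡ ν_f`], obtained per `m` over the member's own coefficient ring `𝒪_m` and DESCENDED to
`R₀⟦T⟧` (`AcSelmer.XAc.map_fittingIdeal_le_span_of_oneSided_congruences_descent_le`). A predicate; NEVER a
theorem in this cell. [claim: Castella2018Erratum, status: under-review]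
[cite: Castella2018Erratum, (b), (c), Lemma 2.1, (2.5), proof of Thm. 1.1 (pp. 2–4) (shape only; nothing asserted)]
[cite: Castella2018, Thm. 3.1, (3.1), (4.1) (arXiv:1704.06608 pp. 9, 11) (shape only; nothing asserted)]
[cite: Skinner2016PacificMC, §3.1 (p. 192) (shape only; nothing asserted)] -/
@[conjecture]
def P2.RoadFF.FittingCongruenceFrameAt : Prop :=
  ∃ (ΩK : ℂ) (Ωp : (unrIntegers p)ˣ) (L LS : UnrSeries p),
    ΩK ≠ 0 ∧ IsBDPLFunction ι 𝔭 κ γ f ΩK ((Ωp : unrIntegers p) : ℂ_[p]) L ∧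
    L * PowerSeries.map (toUnr p) PS ∣ LS ∧
    (Module.fittingIdeal (IwasawaAlgebra p) (XAc (W.baseChange K) p κ 𝔭 S γ) 0).map
        (PowerSeries.map (toUnr p)) ≤ Ideal.span {LS}

variable {W p κ 𝔭 γ ι f S PS}

/-- **THE RECOMBINATION: `Σ`-data ∧ Fitting-level congruence frame ⟹ an `R₀`-frame with
`Ch_Λ(X_ac^∅(E[p^∞]))·R₀⟦T⟧ ⊆ (L)`** (imc24b's `AcSelmer.XAc.charIdeal_map_toUnr_le_span_of_map_fittingIdeal_le`:
torsion bounds, `Σ`-removal, two-prime cancellation in the UFD `R₀⟦T⟧`; no Lemma 2.2). Unconditional in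
the two predicates. [cite: Castella2018Erratum, proof of Thm. 1.1 (p. 4), read one-sidedly] -/
theorem P2.exists_unrFrame_charIdeal_map_le_of_roadFF_fitting [W.IsElliptic]
    (hSD : P2.RoadFF.SigmaDataAt W p κ 𝔭 γ S PS)
    (hF : P2.RoadFF.FittingCongruenceFrameAt W p κ 𝔭 γ ι f S PS) :
    ∃ (ΩK : ℂ) (Ωp : (unrIntegers p)ˣ) (L : UnrSeries p), ΩK ≠ 0 ∧
      IsBDPLFunction ι 𝔭 κ γ f ΩK ((Ωp : unrIntegers p) : ℂ_[p]) L ∧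
      (XAc.charIdeal (W.baseChange K) p κ 𝔭 ∅ γ).map (PowerSeries.map (toUnr p)) ≤
        Ideal.span {L} := by
  obtain ⟨hS, hT, hPS, hX⟩ := hSD
  obtain ⟨ΩK, Ωp, L, LS, hΩ, hL, hLS, key⟩ := hF
  exact ⟨ΩK, Ωp, L, hΩ, hL,
    AcSelmer.XAc.charIdeal_map_toUnr_le_span_of_map_fittingIdeal_le (W.baseChange K) p κ 𝔭 γ hS hT
      key hPS hX hLS⟩

/-- **At a datum: `Σ`-data ∧ Fitting-level congruence frame ⟹ the ♭-frame conjunct of crux 19270**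
(+ imc24c's last mile `P2.exists_intCoreFrame_of_unrFrame_of_charIdeal_map_le`). Unconditional in the two
predicates; closes nothing by itself. [cite: Castella2018Erratum, (2.4) and proof of Thm. 1.1 (p. 4)] -/
theorem P2.exists_intCoreFrame_of_roadFF_fitting [W.IsElliptic]
    (hSD : P2.RoadFF.SigmaDataAt W p κ 𝔭 γ S PS)
    (hF : P2.RoadFF.FittingCongruenceFrameAt W p κ 𝔭 γ ι f S PS) :
    ∃ (ΩK : ℂ) (Ωp : ℂ_[p]) (Q : PowerSeries 𝓞_ℂ_[p]), ΩK ≠ 0 ∧ ‖Ωp‖ = 1 ∧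
      R1.IsBDPLFunctionInt p ι 𝔭 κ γ f ΩK Ωp Q ∧
      (XAc.charIdeal (W.baseChange K) p κ 𝔭 ∅ γ).map (PowerSeries.map (R1.toCpInt p)) ≤
        Ideal.span {Q} := by
  obtain ⟨ΩK, Ωp, L, hΩ, hL, hdiv⟩ := P2.exists_unrFrame_charIdeal_map_le_of_roadFF_fitting hSD hF
  exact P2.exists_intCoreFrame_of_unrFrame_of_charIdeal_map_le W p κ 𝔭 γ ι f hΩ hL hdiv

/-- **NOTHING IS LOST w.r.t. the package of record**: `P2.OneSidedCongruenceDataLeAt W p κ 𝔭 γ ι f`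
(members over the single ring `Λ`) ⟹ both coefficient-free predicates for its own `(Σ, P_Σ)` — the
`Λ`-members feed the Fitting-level limit through imc24b's single-ring one-sided limit
`map_le_span_of_oneSided_congruences_le` packaged as `AcSelmer.XAc.…`; here we route through the proved
frame statement instead: the package gives `S`-data verbatim and the member limit via
`CongruenceDescent`-free imc24b lemma `map_fittingIdeal_le_span_of_congruences_le`. Unconditional.
[cite: Castella2018Erratum, proof of Thm. 1.1 (p. 4)] -/
theorem P2.sigmaDataAt_of_oneSidedCongruenceDataLeAt
    (h : P2.OneSidedCongruenceDataLeAt W p κ 𝔭 γ ι f) :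
    ∃ (S : Set (HeightOneSpectrum (𝓞 K))) (PS : IwasawaAlgebra p),
      P2.RoadFF.SigmaDataAt W p κ 𝔭 γ S PS ∧
        ∃ (ΩK : ℂ) (Ωp : (unrIntegers p)ˣ) (L LS : UnrSeries p),
          ΩK ≠ 0 ∧ IsBDPLFunction ι 𝔭 κ γ f ΩK ((Ωp : unrIntegers p) : ℂ_[p]) L ∧
          L * PowerSeries.map (toUnr p) PS ∣ LS := by
  obtain ⟨ΩK, Ωp, L, S, PS, LS, Nm, Lm, hΩ, hL, hS, hT, hPS, hX, hLS, -, -, -, -⟩ := h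
  exact ⟨S, PS, ⟨hS, hT, hPS, hX⟩, ΩK, Ωp, L, LS, hΩ, hL, hLS⟩

end Shapes

/-! ### On the tree: the two predicates at every erratum datum ⟹ the shape of crux 19270 -/

section OnTree

variable (W : WeierstrassCurve ℚ) [W.IsElliptic] [W.IsGloballyMinimal] (p : ℕ) [Fact p.Prime]
  (Sg : ∀ (K : Type) [Field K] [NumberField K], Set (HeightOneSpectrum (𝓞 K)))
  (PSg : ∀ (K : Type) [Field K] [NumberField K], ZpExtension K p → Field.absoluteGaloisGroup K →
    IwasawaAlgebra p)

/-- **ROAD FF `Σ`-DATA AT EVERY ERRATUM DATUM of `(W, p)` for the choice functions `Sg = Σ(·)`, `PSg = P_Σ(·)` (shape;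
asserts nothing)** — the binders of `P2.IMCDivIntCoreFrameAtErratumData W p` VERBATIM, and at each datum
`P2.RoadFF.SigmaDataAt W p κ 𝔭_{ι'} γ (Sg K) (PSg K κ γ)`. A predicate; NEVER a theorem in this cell.
[claim: Castella2018Erratum, status: under-review]
[cite: Castella2018Erratum, Thm. 1.1 and its proof (pp. 1, 4) (shape only; nothing asserted)] -/
@[conjecture]
def P2.RoadFF.SigmaDataAtErratumData : Prop :=
  ∀ [NeZero (W.conductorNorm ℤ)] (q : ℕ) [Fact q.Prime] (K : Type) [Field K] [NumberField K]
    (Dt : ModularParametrizationData W (W.conductorNorm ℤ))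
    (H : HeegnerDatum (W.conductorNorm ℤ) (NumberField.discr K)) (w₀ : InfinitePlace K)
    (P : (W.baseChange K).toAffine.Point), ErratumHypotheses W p → W.analyticRank = 1 →
    q ≠ p → Mult W q → ¬ W.HasSplitMultiplicativeReductionAtPrime q →
    ¬ p ∣ padicValInt q W.minimalDiscriminantInt → IsErratumField W K q →
    Cas20Standing K p (W.conductorNorm ℤ / p) →
    WeierstrassCurve.Affine.Point.map w₀.embedding.toRatAlgHom P = heegnerPointComplex Dt H →
    ¬ (p : ℤ) ∣ Dt.c → ¬ IsOfFinAddOrder P →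
    ∀ (κ : ZpExtension K p), κ.IsAnticyclotomic →
      ∀ (γ : Field.absoluteGaloisGroup K) [Fact (κ.IsTopGenerator γ)] (ι' : PadicAlgCl p ≃+* ℂ)
        (e : K →+* ℚ_[p]),
        (∀ k : 𝓞 K, k ∈ (primeOfEmbeddingDatum p ι' w₀.embedding).asIdeal ↔ ‖e (k : K)‖ < 1) →
        P2.RoadFF.SigmaDataAt W p κ (primeOfEmbeddingDatum p ι' w₀.embedding) γ (Sg K) (PSg K κ γ)

/-- **ROAD FF FITTING-LEVEL CONGRUENCE FRAME AT EVERY ERRATUM DATUM of `(W, p)` for the choice functions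
`Σ`, `P_Σ` (shape; asserts nothing)** — same binders, and at each datum
`P2.RoadFF.FittingCongruenceFrameAt W p κ 𝔭_{ι'} γ ι' Dt.f (Sg K) (PSg K κ γ)`. The DECIDING predicate of
Road FF (members, FW21 4.41, congruences, descent). A predicate; NEVER a theorem in this cell.
[claim: Castella2018Erratum, status: under-review]
[cite: Castella2018Erratum, Thm. 1.1 and its proof (pp. 1, 4) (shape only; nothing asserted)]
[cite: FouquetWan2021, Thm. 4.41 (shape only; nothing asserted)] -/
@[conjecture]
def P2.RoadFF.FittingCongruenceFrameAtErratumData : Prop :=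
  ∀ [NeZero (W.conductorNorm ℤ)] (q : ℕ) [Fact q.Prime] (K : Type) [Field K] [NumberField K]
    (Dt : ModularParametrizationData W (W.conductorNorm ℤ))
    (H : HeegnerDatum (W.conductorNorm ℤ) (NumberField.discr K)) (w₀ : InfinitePlace K)
    (P : (W.baseChange K).toAffine.Point), ErratumHypotheses W p → W.analyticRank = 1 →
    q ≠ p → Mult W q → ¬ W.HasSplitMultiplicativeReductionAtPrime q →
    ¬ p ∣ padicValInt q W.minimalDiscriminantInt → IsErratumField W K q →
    Cas20Standing K p (W.conductorNorm ℤ / p) →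
    WeierstrassCurve.Affine.Point.map w₀.embedding.toRatAlgHom P = heegnerPointComplex Dt H →
    ¬ (p : ℤ) ∣ Dt.c → ¬ IsOfFinAddOrder P →
    ∀ (κ : ZpExtension K p), κ.IsAnticyclotomic →
      ∀ (γ : Field.absoluteGaloisGroup K) [Fact (κ.IsTopGenerator γ)] (ι' : PadicAlgCl p ≃+* ℂ)
        (e : K →+* ℚ_[p]),
        (∀ k : 𝓞 K, k ∈ (primeOfEmbeddingDatum p ι' w₀.embedding).asIdeal ↔ ‖e (k : K)‖ < 1) →
        P2.RoadFF.FittingCongruenceFrameAt W p κ (primeOfEmbeddingDatum p ι' w₀.embedding) γ ι' Dt.f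
          (Sg K) (PSg K κ γ)

variable {W p Sg PSg}

/-- **THE GLUE, COEFFICIENT-FREE ROAD FF: `Σ`-data and the Fitting-level congruence frame at every erratum
datum (for ANY choice functions `Sg`, `PSg`) ⟹ `P2.IMCDivIntCoreFrameAtErratumData W p`**, the shape of
crux 19270 — the composition a v4 skeleton `IMCDivAtErratumDataAll_of` would use with two stubs.
CONDITIONAL on the two predicates; closes nothing by itself.
[cite: Castella2018Erratum, proof of Thm. 1.1 (p. 4), read one-sidedly] [cite: Skinner2016PacificMC, §3.1 (p. 192)] -/
theorem P2.imcDivIntCoreFrameAtErratumData_of_roadFF_fitting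
    (hSD : P2.RoadFF.SigmaDataAtErratumData W p Sg PSg)
    (hF : P2.RoadFF.FittingCongruenceFrameAtErratumData W p Sg PSg) :
    P2.IMCDivIntCoreFrameAtErratumData W p := by
  intro _ q _ K _ _ Dt H w₀ P hE hr hqp hmq hns hvq hK hCas hP hc hinf κ hκ γ _ ι' e he
  exact P2.exists_intCoreFrame_of_roadFF_fitting
    (hSD q K Dt H w₀ P hE hr hqp hmq hns hvq hK hCas hP hc hinf κ hκ γ ι' e he)
    (hF q K Dt H w₀ P hE hr hqp hmq hns hvq hK hCas hP hc hinf κ hκ γ ι' e he)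

end OnTree

end Summit.BirchSwinnertonDyer.Rank1Residual.X11b

end
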